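import Mathlib

/-!
# Sketch — crux-ideate round 1 (ideator 1) for `TwinTwistorTransport` (stmt-HodgeConjecture-14393)

First lemmas of the two idea cards filed by this seat:

* `ordinary-prime-anchors`  — `frobenius_intertwiner_eq_aeval_comp` (the rank-one Hom-block lemma:
  step (6) of the mod-𝔭 algebraicity argument) and `isometry_iff_ratio_isNorm` is NOT typed (needs
  hermitian forms over CM fields); plus the norm bookkeeping `norm_two_of_similitude_eq_smul_isometry`.
* `reduced-virtual-count-twin-locus` — `vdRed`, `vdRed_two_neg`, `vdRed_three_neg`: the reduced
  virtual dimension (Bae–Kool–Park `rvd = 1 - χ/2 + ρ_γ/2`, `ρ_γ = 20`) of the twin Chern character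
  for vector-bundle carriers of rank 2 and 3 with non-isotropic slices is negative, so the counted
  Chern character must have rank ≥ 4, or rank 0 (PT pairs, `rvd = n - 78`), or negative `ch₄`-defect.
  The Euler pairing `χ(E,E) = 4r² - 4r(a+a') + 2aa' + 44m² + 2r·ch₄` on `S × S″` (HRR, td = (1+2p)(1+2p″),
  ∫γ² = 44) was re-derived by this seat (calc/window.py) and agrees with TRIAGE-r1-1 finding K3.
-/

namespace Summit.HodgeConjecture.HodgeConjecture.Cruxes.TwinTwistorTransport.IdeaSketchR1K1

open Polynomial

section HomBlock

variable {L : Type*} [Field L] {T T'' : Type*}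
  [AddCommGroup T] [Module L T] [FiniteDimensional L T]
  [AddCommGroup T''] [Module L T''] [FiniteDimensional L T'']

/-- **Rank-one Hom block.** If `F` (Frobenius on `T_ℓ(S₀)`) has irreducible characteristic
polynomial and `Ψ : T'' ≃ T` intertwines `F''` with `F` (the reduced twin class), then every
intertwiner `φ` (every Tate class of the `Hom(h²(S₀″), h²(S₀))` block) is `p(F) ∘ Ψ` for a polynomial
`p` — the block is free of rank one over `L[F] ≅ L[X]/(charpoly F)`.  With `Ψ` replaced by an
ALGEBRAIC isometry `u` (Yang 2018/2022 under condition (N)) and `L[F]`-multiples algebraic by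
Ito–Ito–Koshikawa (Tate for `S₀ × S₀`), this is the dimension count making all Tate classes of the
block algebraic.  Provable now (simple `L[X]`-module argument). -/
theorem frobenius_intertwiner_eq_aeval_comp
    (F : Module.End L T) (F'' : Module.End L T'')
    (hirr : Irreducible F.charpoly)
    (Ψ : T'' ≃ₗ[L] T) (hΨ : Ψ.toLinearMap ∘ₗ F'' = F ∘ₗ Ψ.toLinearMap)
    (φ : T'' →ₗ[L] T) (hφ : φ ∘ₗ F'' = F ∘ₗ φ) :
    ∃ p : L[X], φ = (aeval F p).comp Ψ.toLinearMap := by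
  sorry

/-- The commutant form of the same statement: an endomorphism commuting with a cyclic `F` of
irreducible characteristic polynomial is a polynomial in `F`. -/
theorem commute_eq_aeval_of_irreducible_charpoly
    (F : Module.End L T) (hirr : Irreducible F.charpoly)
    (ψ : Module.End L T) (hψ : ψ ∘ₗ F = F ∘ₗ ψ) :
    ∃ p : L[X], ψ = aeval F p := by
  sorry

end HomBlock

section NormBookkeeping

/-- **Norm bookkeeping for condition (N).**  Over any field, if `B` is a symmetric bilinear form,
`u` an isometry of `B''` into `B`, `e` a `B`-self-map with `B (e x) (e y) = c * B x y`
(a similitude of multiplier `c`, e.g. a CM element of norm `c`), and `γ = e ∘ u` is a similitude of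
multiplier `2`, then `c = 2` as soon as `B''` is non-zero somewhere: the algebraic isometry `u`
and the CM endomorphism `e` can only compose to the twin class if `2` is a norm.  (Elementary; the
content of (N) is the EXISTENCE of `u`, not this identity.) -/
theorem multiplier_eq_two_of_comp
    {K : Type*} [Field K] {V V'' : Type*} [AddCommGroup V] [Module K V]
    [AddCommGroup V''] [Module K V'']
    (B : LinearMap.BilinForm K V) (B'' : LinearMap.BilinForm K V'')
    (u : V'' →ₗ[K] V) (hu : ∀ x y, B (u x) (u y) = B'' x y)
    (e : V →ₗ[K] V) (c : K) (he : ∀ x y, B (e x) (e y) = c * B x y)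
    (hγ : ∀ x y, B (e (u x)) (e (u y)) = 2 * B'' x y)
    (x₀ y₀ : V'') (h₀ : B'' x₀ y₀ ≠ 0) : c = 2 := by
  have h1 := he (u x₀) (u y₀)
  rw [hu, hγ] at h1
  exact (mul_right_cancel₀ h₀ h1).symm

end NormBookkeeping

section Window

/-- Reduced virtual dimension (Bae–Kool–Park, `rvd = 1 - χ(E,E)/2 + ρ_γ/2` with `ρ_γ = 20`) of the
moduli of torsion-free carriers on the twin fourfold `S × S″` with
`ch = (r, 0, -(2γ + a p + a' p″), 0, ch₄)`, specialised to VECTOR BUNDLES of rank `r ≤ 3`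
(`c₃ = c₄ = 0`, so `ch₄ = c₂²/12 = (2aa' + 176)/12`):
`χ(E,E) = 4r² - 4r(a+a') + 2aa' + 176 + 2r·ch₄`. -/
def vdRed (r a a' : ℚ) : ℚ :=
  11 - (2 * r ^ 2 - 2 * r * (a + a') + a * a' + 88 + r * ((a * a' + 88) / 6))

/-- Rank 2 bundles with non-isotropic slices (`a, a' ≥ 3 = r + 1`; `a = 2` forces isotropic
slice Mukai vectors, i.e. the Nikulin/FM configuration excluded at a general twin) have negative
reduced virtual dimension: the reduced count of such bundles is zero for dimension reasons. -/
theorem vdRed_two_neg (a a' : ℚ) (ha : 3 ≤ a) (ha' : 3 ≤ a') : vdRed 2 a a' < 0 := by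
  unfold vdRed
  nlinarith [mul_nonneg (sub_nonneg.mpr ha) (sub_nonneg.mpr ha')]

/-- Same for rank 3 (`a, a' ≥ 4`). -/
theorem vdRed_three_neg (a a' : ℚ) (ha : 4 ≤ a) (ha' : 4 ≤ a') : vdRed 3 a a' < 0 := by
  unfold vdRed
  nlinarith [mul_nonneg (sub_nonneg.mpr ha) (sub_nonneg.mpr ha')]

/-- PT-pair (rank 0, surface-counting) version: `rvd = n - γ²/2 + ρ_γ/2 = n - 78` for the bare
twin class (`γ² = 176`, `ρ_γ = 20`); non-negative iff `n ≥ 78`. -/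
theorem rvd_pairs_nonneg_iff (n : ℤ) : 0 ≤ n - 176 / 2 + 20 / 2 ↔ 78 ≤ n := by
  omega

end Window

end Summit.HodgeConjecture.HodgeConjecture.Cruxes.TwinTwistorTransport.IdeaSketchR1K1
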